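import Literature.NumberTheory.Automorphic.StrongArtinGL2WeightOneDictionary
import HarnessLib

/-!
# Transfer of archimedean parameters, weight one and Satake parameters along `W₀ ≅ W / W'`
(a subrepresentation realising a subquotient; Borel–Jacquet 1979, 4.6)

Topic `NumberTheory/Automorphic`. In the Borel–Jacquet formalism of the tree an automorphic
representation is a datum `π = W / W'` (`AutomorphicRepData`), and the invariants read off it —
the archimedean parameter (`AutomorphicRepData.HasArchParameter`, through a Lie algebra action on
`W / W'` and `HasHCParameter`), the weight-one predicate `AutomorphicRepData.IsOfWeightOne`
(`StrongArtinGL2WeightOneDictionary`), the Satake parameters (`HasSatakeParamAt`, eigenvectors *modulo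
`W'`*) — are statements modulo `W'`. For a cuspidal `π` the named fact
`AutomorphicRepsGL.cuspidal_W'_eq_bot` (Borel–Jacquet 4.6, semisimplicity of the space of cusp
forms) supplies a datum `π₀ = W₀ / ⊥` with `W₀ ⊓ W' = ⊥`, `W₀ ⊔ W' = W`, on which everything is exact.
This file records that hypothesis as `AutomorphicRepData.IsSubRealisation π π₀` and **proves the
transfers** needed to work with `π₀` in place of `π`:

* `LieHom.conjBy`, `LieHom.lift_conjBy`, `HasCentralCharacter.conjBy`, `HasHCParameter.conjBy`,
  `HasArchParameter.conjBy` — conjugating a Lie algebra representation by a linear isomorphism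
  conjugates its enveloping-algebra action (uniqueness of `lift`), so central characters,
  Harish-Chandra parameters and archimedean parameters are preserved;
* `IsSubRealisation.quotEquiv : W₀ / ⊥ ≃ₗ[ℂ] W / W'` (injective by `W₀ ⊓ W' = ⊥`, surjective by
  `W₀ ⊔ W' = W`), `quotEquiv_mkQ`, and `IsSubRealisation.hasLieAction_conjBy` — the conjugate of the
  Lie algebra action of `π` is the Lie algebra action of `π₀` (`[Xφ]₀ ↦ [Xφ]`);
* `IsSubRealisation.hasArchParameter` — **`π₀` has the archimedean parameter of `π`**;
  `IsSubRealisation.isOfWeightOne` — **`π₀` is of weight one if `π` is** (the sign condition: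
  `r(-1_∞)φ + φ ∈ W₀ ∩ W' = 0 = W₀'`); `IsSubRealisation.hasSatakeParamAt` — **Satake parameters of `π₀`
  are Satake parameters of `π`** (`W₀ ≤ W`, an eigenvector in `W₀ ∖ 0` is not in `W'`, and eigen modulo
  `⊥` is eigen modulo `W'`).

Everything is proved; the definitions are `LieHom.conjBy`, the structure `IsSubRealisation` and the
maps `incl`, `toQuot`, `quotEquiv`.

## References

* A. Borel, H. Jacquet, *Automorphic forms and automorphic representations*, Proc. Sympos. Pure
  Math. 33 (1979), Part 1, 4.6 [BorelJacquet1979].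
* L. Clozel, *Motifs et formes automorphes*, in *Automorphic forms, Shimura varieties, and
  L-functions* I (1990), §3.3 [Clozel1990].
* S. Gelbart, *Three lectures …* (1997), Remark 2.5.2 [Gelbart1997].
* A. W. Knapp, *Lie Groups Beyond an Introduction* (2002), Thm. 5.44 [Knapp2002].
-/

noncomputable section

-- Mathlib idiom (Mathlib/Algebra/Lie/OfAssociative.lean); needed to mention Lie subalgebras of matrix algebras
attribute [local instance 100] LieRing.ofAssociativeRing

open scoped MatrixGroups Matrix Classical
open NumberField NumberField.mixedEmbedding IsDedekindDomain

namespace Literature.NumberTheory.Automorphic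

/-! ### Central characters are invariant under conjugation by a linear isomorphism -/

section Conj

variable {L : Type*} [LieRing L] [LieAlgebra ℝ L] {V₁ V₂ : Type*} [AddCommGroup V₁] [Module ℂ V₁]
  [AddCommGroup V₂] [Module ℂ V₂]

/-- Conjugation of a real Lie algebra representation on a complex space by a complex-linear
isomorphism `e : V₁ ≃ V₂`: `X ↦ e ∘ ρ(X) ∘ e⁻¹`. [folklore] -/
def LieHom.conjBy (ρ : L →ₗ⁅ℝ⁆ Module.End ℂ V₁) (e : V₁ ≃ₗ[ℂ] V₂) : L →ₗ⁅ℝ⁆ Module.End ℂ V₂ :=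
  ((e.conjAlgEquiv ℝ).toAlgHom.toLieHom).comp ρ

/-- `conjBy ρ e X v = e (ρ X (e⁻¹ v))`. [folklore] -/
@[simp] theorem LieHom.conjBy_apply (ρ : L →ₗ⁅ℝ⁆ Module.End ℂ V₁) (e : V₁ ≃ₗ[ℂ] V₂) (X : L) (v : V₂) :
    LieHom.conjBy ρ e X v = e (ρ X (e.symm v)) := rfl

/-- The enveloping algebra action of the conjugate is the conjugate of the enveloping algebra action:
`lift (e ρ e⁻¹) = e (lift ρ) e⁻¹` (uniqueness of `lift`). [folklore] -/
theorem LieHom.lift_conjBy (ρ : L →ₗ⁅ℝ⁆ Module.End ℂ V₁) (e : V₁ ≃ₗ[ℂ] V₂) :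
    UniversalEnvelopingAlgebra.lift ℝ (LieHom.conjBy ρ e) =
      ((e.conjAlgEquiv ℝ).toAlgHom).comp (UniversalEnvelopingAlgebra.lift ℝ ρ) := by
  symm
  rw [← UniversalEnvelopingAlgebra.lift_unique]
  funext X
  simp only [Function.comp_apply, AlgHom.coe_comp, UniversalEnvelopingAlgebra.lift_ι_apply]
  rfl

/-- **A central character is preserved by conjugation.** [folklore] -/
theorem HasCentralCharacter.conjBy {ρ : L →ₗ⁅ℝ⁆ Module.End ℂ V₁}
    {θ : Subalgebra.center ℝ (UniversalEnvelopingAlgebra ℝ L) →ₐ[ℝ] ℂ} (h : HasCentralCharacter ρ θ)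
    (e : V₁ ≃ₗ[ℂ] V₂) : HasCentralCharacter (LieHom.conjBy ρ e) θ := by
  intro z
  rw [LieHom.lift_conjBy, AlgHom.comp_apply, h z]
  refine LinearMap.ext fun v => ?_
  change e ((algebraMap ℂ (Module.End ℂ V₁) (θ z)) (e.symm v)) = _
  rw [Module.algebraMap_end_apply, Module.algebraMap_end_apply, map_smul, LinearEquiv.apply_symm_apply]

/-- Conjugation commutes with composition in the Lie algebra argument. [folklore] -/
theorem LieHom.conjBy_comp {L' : Type*} [LieRing L'] [LieAlgebra ℝ L'] (ρ : L →ₗ⁅ℝ⁆ Module.End ℂ V₁)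
    (e : V₁ ≃ₗ[ℂ] V₂) (f : L' →ₗ⁅ℝ⁆ L) : (LieHom.conjBy ρ e).comp f = LieHom.conjBy (ρ.comp f) e := rfl

/-- **A Harish-Chandra parameter is preserved by conjugation** (`𝔤𝔩ₙ(𝕜)`-modules). [cite: Knapp2002, Thm. 5.44] -/
theorem HasHCParameter.conjBy {𝕜 : Type*} [RCLike 𝕜] {n : ℕ}
    {ρ : Matrix (Fin n) (Fin n) 𝕜 →ₗ⁅ℝ⁆ Module.End ℂ V₁} {χ : (𝕜 →ₐ[ℝ] ℂ) → Multiset ℂ}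
    (h : HasHCParameter ρ χ) (e : V₁ ≃ₗ[ℂ] V₂) : HasHCParameter (LieHom.conjBy ρ e) χ := by
  obtain ⟨hcard, θ, hθ, hγ⟩ := h
  exact ⟨hcard, θ, hθ.conjBy e, hγ⟩

/-- **An archimedean parameter of `𝔤𝔩ₙ(K_∞)` is preserved by conjugation.** [cite: Clozel1990, §3.3] -/
theorem HasArchParameter.conjBy {K : Type*} [Field K] {n : ℕ}
    {ρ : Matrix (Fin n) (Fin n) (mixedSpace K) →ₗ⁅ℝ⁆ Module.End ℂ V₁} {χ : (K →+* ℂ) → Multiset ℂ}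
    (h : Automorphic.HasArchParameter ρ χ) (e : V₁ ≃ₗ[ℂ] V₂) :
    Automorphic.HasArchParameter (LieHom.conjBy ρ e) χ :=
  ⟨fun w => by rw [LieHom.conjBy_comp]; exact (h.1 w).conjBy e,
    fun w => by rw [LieHom.conjBy_comp]; exact (h.2 w).conjBy e⟩

end Conj

/-! ### The isomorphism `W₀ ≅ W / W'` for a complementary subrepresentation -/

namespace AutomorphicRepData

variable {K : Type} [Field K] [NumberField K]
  {A : Type*} [NormedCommRing A] [NormedAlgebra ℝ A] [NormedAlgebra ℚ A] [CompleteSpace A] [StarRing A]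
  {N : Type*} [Fintype N] [DecidableEq N]
  {𝒢 : AdelicGroupData K} {𝒟 : AutomorphyDatum 𝒢 A N} (π π₀ : AutomorphicRepData 𝒟)

/-- Data of a **subrepresentation realising the subquotient** `π = W / W'`: a datum `π₀ = W₀ / ⊥`
with `W₀ ⊓ W' = ⊥` and `W₀ ⊔ W' = W` (the conclusion of `cuspidal_W'_eq_bot` of `AutomorphicRepsGL`
for cuspidal `π`; Borel–Jacquet 1979, 4.6: cusp forms are semisimple). [cite: BorelJacquet1979, 4.6] -/
structure IsSubRealisation : Prop where
  /-- `W₀' = ⊥`. -/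
  bot : π₀.W' = ⊥
  /-- `W₀ ⊓ W' = ⊥`. -/
  inf : π₀.W ⊓ π.W' = ⊥
  /-- `W₀ ⊔ W' = W`. -/
  sup : π₀.W ⊔ π.W' = π.W

variable {π π₀}

namespace IsSubRealisation

/-- `W₀ ≤ W`. [folklore] -/
theorem le (h : IsSubRealisation π π₀) : π₀.W ≤ π.W := by
  rw [← h.sup]; exact le_sup_left

/-- The inclusion `W₀ → W`. [folklore] -/
def incl (h : IsSubRealisation π π₀) : π₀.W →ₗ[ℂ] π.W := Submodule.inclusion h.le

/-- The map `W₀ / ⊥ → W / W'` induced by the inclusion. [folklore] -/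
def toQuot (h : IsSubRealisation π π₀) : π₀.Quot →ₗ[ℂ] π.Quot :=
  π₀.kerQuot.liftQ (π.mkQ ∘ₗ h.incl) (by
    intro φ hφ
    have h0 : (φ : 𝒢.Adelic → ℂ) ∈ π₀.W' := hφ
    rw [h.bot, Submodule.mem_bot] at h0
    rw [LinearMap.mem_ker, LinearMap.comp_apply]
    have : h.incl φ = 0 := Subtype.ext h0
    rw [this, map_zero])

/-- `toQuot [φ]₀ = [φ]`. [folklore] -/
theorem toQuot_mkQ (h : IsSubRealisation π π₀) (φ : π₀.W) :
    h.toQuot (π₀.mkQ φ) = π.mkQ ⟨φ, h.le φ.2⟩ := rfl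

/-- `toQuot` is injective (`W₀ ⊓ W' = ⊥`). [folklore] -/
theorem toQuot_injective (h : IsSubRealisation π π₀) : Function.Injective h.toQuot := by
  rw [← LinearMap.ker_eq_bot, Submodule.eq_bot_iff]
  intro x hx
  obtain ⟨φ, rfl⟩ := Submodule.Quotient.mk_surjective π₀.kerQuot x
  change h.toQuot (π₀.mkQ φ) = 0 at hx
  rw [toQuot_mkQ, Submodule.mkQ_apply, Submodule.Quotient.mk_eq_zero] at hx
  have hφ' : (φ : 𝒢.Adelic → ℂ) ∈ π.W' := hx
  have hφ0 : (φ : 𝒢.Adelic → ℂ) ∈ π₀.W ⊓ π.W' := ⟨φ.2, hφ'⟩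
  rw [h.inf, Submodule.mem_bot] at hφ0
  have : φ = 0 := Subtype.ext hφ0
  rw [this]
  exact Submodule.Quotient.mk_zero _

/-- `toQuot` is surjective (`W₀ ⊔ W' = W`). [folklore] -/
theorem toQuot_surjective (h : IsSubRealisation π π₀) : Function.Surjective h.toQuot := by
  intro y
  obtain ⟨ψ, rfl⟩ := Submodule.Quotient.mk_surjective π.kerQuot y
  have hψ : (ψ : 𝒢.Adelic → ℂ) ∈ π₀.W ⊔ π.W' := by rw [h.sup]; exact ψ.2
  obtain ⟨φ, hφ, w, hw, hsum⟩ := Submodule.mem_sup.1 hψ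
  refine ⟨π₀.mkQ ⟨φ, hφ⟩, ?_⟩
  rw [toQuot_mkQ]
  change π.mkQ ⟨φ, h.le hφ⟩ = π.mkQ ψ
  rw [Submodule.mkQ_apply, Submodule.mkQ_apply, Submodule.Quotient.eq]
  change ((⟨φ, h.le hφ⟩ : π.W) - ψ : π.W).1 ∈ π.W'
  have : ((⟨φ, h.le hφ⟩ : π.W) - ψ : π.W).1 = -w := by
    change φ - (ψ : 𝒢.Adelic → ℂ) = -w
    rw [← hsum]; abel
  rw [this]
  exact π.W'.neg_mem hw

/-- **`W₀ / ⊥ ≅ W / W'`.** [cite: BorelJacquet1979, 4.6] -/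
def quotEquiv (h : IsSubRealisation π π₀) : π₀.Quot ≃ₗ[ℂ] π.Quot :=
  LinearEquiv.ofBijective h.toQuot ⟨h.toQuot_injective, h.toQuot_surjective⟩

/-- `quotEquiv [φ]₀ = [φ]`. [folklore] -/
theorem quotEquiv_mkQ (h : IsSubRealisation π π₀) (φ : π₀.W) :
    h.quotEquiv (π₀.mkQ φ) = π.mkQ ⟨φ, h.le φ.2⟩ := rfl

/-- **The Lie algebra action transfers**: if `ρ𝔤` is the Lie algebra action of `π` on `W / W'`, then
its conjugate by `W₀/⊥ ≅ W/W'` is the Lie algebra action of `π₀`. [cite: BorelJacquet1979, 4.6] -/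
theorem hasLieAction_conjBy (h : IsSubRealisation π π₀) {ρ𝔤 : 𝒟.arch.lie →ₗ⁅ℝ⁆ Module.End ℂ π.Quot}
    (hρ : π.HasLieAction ρ𝔤) : π₀.HasLieAction (LieHom.conjBy ρ𝔤 h.quotEquiv.symm) := by
  intro X φ
  rw [LieHom.conjBy_apply, LinearEquiv.symm_symm, quotEquiv_mkQ, hρ X ⟨φ, h.le φ.2⟩, LinearEquiv.symm_apply_eq,
    quotEquiv_mkQ]
  rfl

end IsSubRealisation

end AutomorphicRepData

/-! ### `GL_n`: archimedean parameters, weight one, Satake parameters -/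

namespace AutomorphicRepData

variable {n : ℕ} {K : Type} [Field K] [NumberField K] {hcpt : isCompact_glFiniteIntegralLevel n K}
  {π π₀ : AutomorphicRepData (AutomorphyDatum.gl n K hcpt)}

/-- **The archimedean parameter transfers to a subrepresentation realising `W / W'`.**
[cite: Clozel1990, §3.3] [cite: BorelJacquet1979, 4.6] -/
theorem IsSubRealisation.hasArchParameter (h : IsSubRealisation π π₀) {χ : (K →+* ℂ) → Multiset ℂ}
    (hπ : π.HasArchParameter χ) : π₀.HasArchParameter χ := by
  obtain ⟨ρ𝔤, hLie, hpar⟩ := hπ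
  refine ⟨LieHom.conjBy ρ𝔤 h.quotEquiv.symm, h.hasLieAction_conjBy hLie, ?_⟩
  rw [LieHom.conjBy_comp]
  exact hpar.conjBy _

/-- **Satake parameters of the subrepresentation are Satake parameters of `π`** (`W₀ ≤ W`,
`W₀ ∩ W' = 0`, and an eigenvector modulo `⊥` is an eigenvector modulo `W'`). [cite: BorelJacquet1979, 4.6] -/
theorem IsSubRealisation.hasSatakeParamAt (h : IsSubRealisation π π₀) {v : IsDedekindDomain.HeightOneSpectrum (𝓞 K)}
    {α : Multiset ℂ} (h₀ : π₀.HasSatakeParamAt v α) : π.HasSatakeParamAt v α := by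
  obtain ⟨𝔫, ϖ, h𝔫, hv, hϖ, hcard, φ, hφW, hφW', hinv, heig⟩ := h₀
  refine ⟨𝔫, ϖ, h𝔫, hv, hϖ, hcard, φ, h.le hφW, ?_, hinv, fun i hi => ?_⟩
  · intro hφ'
    have hφ0 : φ ∈ π₀.W ⊓ π.W' := ⟨hφW, hφ'⟩
    rw [h.inf, Submodule.mem_bot] at hφ0
    rw [hφ0, h.bot] at hφW'
    exact hφW' (Submodule.zero_mem _)
  · have h1 := heig i hi
    rw [h.bot, Submodule.mem_bot] at h1
    rw [h1]
    exact Submodule.zero_mem _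

end AutomorphicRepData

/-! ### Weight one -/

namespace AutomorphicRepData

variable {hcpt : isCompact_glFiniteIntegralLevel 2 ℚ} {π π₀ : AutomorphicRepData (AutomorphyDatum.gl 2 ℚ hcpt)}

/-- **Weight one transfers to a subrepresentation realising `W / W'`**: the parameter `{0, 0}`
transfers (`IsSubRealisation.hasArchParameter`) and `r(-1_∞) φ + φ ∈ W₀ ∩ W' = 0 = W₀'`.
[cite: Gelbart1997, Remark 2.5.2] [cite: BorelJacquet1979, 4.6] -/
theorem IsSubRealisation.isOfWeightOne (h : IsSubRealisation π π₀) (hπ : π.IsOfWeightOne) : π₀.IsOfWeightOne := by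
  refine ⟨h.hasArchParameter hπ.1, fun φ hφ => ?_⟩
  have h1 := hπ.2 φ (h.le hφ)
  have hmem : ((-1 : GL (Fin 2) (mixedSpace ℚ))) ∈ (AutomorphyDatum.gl 2 ℚ hcpt).arch.maximalCompact := by
    refine ⟨Subgroup.mem_top _, ?_⟩
    change (-1 : GL (Fin 2) (mixedSpace ℚ)) ∈ unitarySubgroupGL (mixedSpace ℚ) (Fin 2)
    rw [mem_unitarySubgroupGL_iff]
    simp
  have h2 : rightTranslation (AdelicGroupData.gl 2 ℚ) ((AutomorphyDatum.gl 2 ℚ hcpt).ofArch ⟨-1, trivial⟩) φ + φ ∈ π₀.W :=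
    π₀.W.add_mem (π₀.stable.k_stable ⟨-1, hmem⟩ hφ) hφ
  have h3 : rightTranslation (AdelicGroupData.gl 2 ℚ) ((AutomorphyDatum.gl 2 ℚ hcpt).ofArch ⟨-1, trivial⟩) φ + φ ∈ π₀.W ⊓ π.W' :=
    ⟨h2, h1⟩
  rw [h.inf] at h3
  rw [h.bot]
  exact h3

end AutomorphicRepData

end Literature.NumberTheory.Automorphic

end
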